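import Summits.Parity.GeneralizedHardyLittlewood.Theorems.FordMaynardSieveConst01651SieveConst01651Pieces
import HarnessLib

/-!
# Route `FordMaynardSieveConst01651`, target `SieveConst01651` (stmt-Parity-19185), stub `stub_coneCertClosed`,
# conjunct (i) for the witness `coneCert`: the TABLE parts (dimensions 2 and 3) and the assembled conjunct (i)

Def-free helper file, second half of conjunct (i) (`…Pieces` did the faces and dimensions `0, 1, ≥ 4`):

* `isConvexPolytope_cellPiece_two a b j` / `_three a b c` — the open table pieces (open cells × open band, resp. open
  cells with `|y| < 1/2`), cut by the cone, are convex polytopes in the cone;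
* `coneRep_gTab_two`, `coneRep_gTab_three` — `gTab 2`, `gTab 3` are the sums over ALL index triples
  (`(Fin 84 × Fin 84) × Fin 2`, resp. `× Fin 84`) of `lookup/10⁶ × 𝟙[piece]`: at a point of an open piece exactly the piece of
  `(cellIdx x₀, cellIdx x₁, bandIdx (x₀+x₁))` fires (`cellIdx_eq_of_mem_cell`, `cellIdx_spec`), elsewhere none;
* `isPiecewiseConstOnCone_coneCert` — **conjunct (i) of `stub_coneCertClosed` for the witness `coneCert`.**

References: [FordMaynard2024PrimeSieves] arXiv:2407.14368, Definitions 5.7, 7.2.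
-/

noncomputable section

open Finset
open scoped Classical
open Literature.NumberTheory.Sieve Literature.NumberTheory.Sieve.FordMaynard

namespace Summit.Parity.GeneralizedHardyLittlewood.FordMaynardSieveConst01651SieveConst01651

/-! ### The open table pieces are convex polytopes in the cone -/

/-- A point of an open cell `(e_a, e_{a+1})`, `a ≤ 83`, lies in `(ν₀, 1/2)`, hence in `(0, 1/2)`. [folklore] -/
theorem pos_of_mem_cell {t : ℝ} {a : ℕ} (ha : a ≤ 83) (h1 : ((certEdge a : ℚ) : ℝ) < t)
    (h2 : t < ((certEdge (a + 1) : ℚ) : ℝ)) : 0 < t ∧ t < 1 / 2 := by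
  have h := mem_openSmall_of_mem_cell ha h1 h2
  exact ⟨by linarith [h.1], h.2.1⟩

/-- The dimension-2 table piece of `(a, b, j)`: `x₀ ≤ x₁`, `x₀ ∈ (e_a, e_{a+1})`, `x₁ ∈ (e_b, e_{b+1})`, open band `j`
(`0`: `x₀ + x₁ < c₀`; else `c₀ < x₀ + x₁`), `x₀ + x₁ < 1/2` — a convex polytope in the cone (for `a, b ≤ 83`).
[cite: FordMaynard2024PrimeSieves, Definitions 5.7, 7.2] -/
theorem isConvexPolytope_cellPiece_two {a b : ℕ} (ha : a ≤ 83) (hb : b ≤ 83) (j : ℕ) :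
    IsConvexPolytope {x : Fin 2 → ℝ | Monotone x ∧ ((certEdge a : ℚ) : ℝ) < x 0 ∧ x 0 < ((certEdge (a + 1) : ℚ) : ℝ) ∧
        ((certEdge b : ℚ) : ℝ) < x 1 ∧ x 1 < ((certEdge (b + 1) : ℚ) : ℝ) ∧
        (if j = 0 then x 0 + x 1 < 8349 / 20000 else (8349 / 20000 : ℝ) < x 0 + x 1) ∧ x 0 + x 1 < 1 / 2} ∧
      {x : Fin 2 → ℝ | Monotone x ∧ ((certEdge a : ℚ) : ℝ) < x 0 ∧ x 0 < ((certEdge (a + 1) : ℚ) : ℝ) ∧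
        ((certEdge b : ℚ) : ℝ) < x 1 ∧ x 1 < ((certEdge (b + 1) : ℚ) : ℝ) ∧
        (if j = 0 then x 0 + x 1 < 8349 / 20000 else (8349 / 20000 : ℝ) < x 0 + x 1) ∧ x 0 + x 1 < 1 / 2} ⊆
        {x | Monotone x} := by
  set ea : ℝ := ((certEdge a : ℚ) : ℝ)
  set ea' : ℝ := ((certEdge (a + 1) : ℚ) : ℝ)
  set eb : ℝ := ((certEdge b : ℚ) : ℝ)
  set eb' : ℝ := ((certEdge (b + 1) : ℚ) : ℝ)
  -- `Q` = the constraints without monotonicity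
  set Q : Set (Fin 2 → ℝ) := {x | ea < x 0 ∧ x 0 < ea' ∧ eb < x 1 ∧ x 1 < eb' ∧
      (if j = 0 then x 0 + x 1 < 8349 / 20000 else (8349 / 20000 : ℝ) < x 0 + x 1) ∧ x 0 + x 1 < 1 / 2} with hQ
  -- sign of the band constraint
  set σ : ℝ := if j = 0 then 1 else -1 with hσ
  set β : ℝ := if j = 0 then 8349 / 20000 else -(8349 / 20000) with hβ
  have hband : ∀ x : Fin 2 → ℝ, (σ * x 0 + σ * x 1 < β) ↔
      (if j = 0 then x 0 + x 1 < 8349 / 20000 else (8349 / 20000 : ℝ) < x 0 + x 1) := by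
    intro x; by_cases hj : j = 0
    · simp only [hσ, hβ, hj, if_true]; constructor <;> intro h <;> linarith
    · simp only [hσ, hβ, hj, if_false]; constructor <;> intro h <;> linarith
  have hQpoly : IsConvexPolytope Q := by
    -- strict constraints indexed by `Fin 6`: coefficients of `x 0`, `x 1`, right-hand sides
    let c0 : Fin 6 → ℝ := fun m => if m = 0 then -1 else if m = 1 then 1 else if m = 2 then 0 else if m = 3 then 0
      else if m = 4 then σ else 1
    let c1 : Fin 6 → ℝ := fun m => if m = 0 then 0 else if m = 1 then 0 else if m = 2 then -1 else if m = 3 then 1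
      else if m = 4 then σ else 1
    let rhs : Fin 6 → ℝ := fun m => if m = 0 then -ea else if m = 1 then ea' else if m = 2 then -eb else if m = 3 then eb'
      else if m = 4 then β else 1 / 2
    refine isConvexPolytope_of_constraints (ι₁ := Fin 6) (ι₂ := Fin 0)
      (fun m l => if l = 0 then c0 m else c1 m) rhs Fin.elim0 Fin.elim0 ?_ fun x => ?_
    · refine (Metric.isBounded_Icc (fun _ : Fin 2 => (0 : ℝ)) (fun _ => 1 / 2)).subset ?_
      intro x hx
      obtain ⟨h1, h2, h3, h4, -, h6⟩ := hx
      have p0 := pos_of_mem_cell ha h1 h2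
      have p1 := pos_of_mem_cell hb h3 h4
      refine ⟨fun i => ?_, fun i => ?_⟩ <;> fin_cases i <;> simp <;> linarith [p0.1, p1.1, p0.2, p1.2]
    · have hsum : ∀ m : Fin 6, ∑ l : Fin 2, (if l = 0 then c0 m else c1 m) * x l = c0 m * x 0 + c1 m * x 1 := by
        intro m; rw [Fin.sum_univ_two]; simp
      simp only [hsum, IsEmpty.forall_iff, and_true, hQ, Set.mem_setOf_eq]
      rw [← hband x]
      constructor
      · rintro ⟨h1, h2, h3, h4, h5, h6⟩ m
        fin_cases m <;> simp [c0, c1, rhs] <;> linarith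
      · intro h
        have h0 := h 0; have h1 := h 1; have h2 := h 2; have h3 := h 3; have h4 := h 4; have h5 := h 5
        simp [c0, c1, rhs] at h0 h1 h2 h3 h4 h5
        refine ⟨by linarith, by linarith, by linarith, by linarith, by linarith, by linarith⟩
  have hset : {x : Fin 2 → ℝ | Monotone x ∧ ea < x 0 ∧ x 0 < ea' ∧ eb < x 1 ∧ x 1 < eb' ∧
        (if j = 0 then x 0 + x 1 < 8349 / 20000 else (8349 / 20000 : ℝ) < x 0 + x 1) ∧ x 0 + x 1 < 1 / 2} =
      Q ∩ {x | Monotone x} := by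
    ext x; simp only [hQ, Set.mem_inter_iff, Set.mem_setOf_eq]; tauto
  rw [hset]
  exact isConvexPolytope_inter_cone hQpoly

/-- The dimension-3 table piece of `(a, b, c)`: monotone, coordinates in the open cells `a, b, c`, `|x| < 1/2` — a convex
polytope in the cone (for `a, b, c ≤ 83`). [cite: FordMaynard2024PrimeSieves, Definitions 5.7, 7.2] -/
theorem isConvexPolytope_cellPiece_three {a b c : ℕ} (ha : a ≤ 83) (hb : b ≤ 83) (hc : c ≤ 83) :
    IsConvexPolytope {x : Fin 3 → ℝ | Monotone x ∧ ((certEdge a : ℚ) : ℝ) < x 0 ∧ x 0 < ((certEdge (a + 1) : ℚ) : ℝ) ∧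
        ((certEdge b : ℚ) : ℝ) < x 1 ∧ x 1 < ((certEdge (b + 1) : ℚ) : ℝ) ∧
        ((certEdge c : ℚ) : ℝ) < x 2 ∧ x 2 < ((certEdge (c + 1) : ℚ) : ℝ) ∧ ∑ i, x i < 1 / 2} ∧
      {x : Fin 3 → ℝ | Monotone x ∧ ((certEdge a : ℚ) : ℝ) < x 0 ∧ x 0 < ((certEdge (a + 1) : ℚ) : ℝ) ∧
        ((certEdge b : ℚ) : ℝ) < x 1 ∧ x 1 < ((certEdge (b + 1) : ℚ) : ℝ) ∧
        ((certEdge c : ℚ) : ℝ) < x 2 ∧ x 2 < ((certEdge (c + 1) : ℚ) : ℝ) ∧ ∑ i, x i < 1 / 2} ⊆ {x | Monotone x} := by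
  set ea : ℝ := ((certEdge a : ℚ) : ℝ)
  set ea' : ℝ := ((certEdge (a + 1) : ℚ) : ℝ)
  set eb : ℝ := ((certEdge b : ℚ) : ℝ)
  set eb' : ℝ := ((certEdge (b + 1) : ℚ) : ℝ)
  set ec : ℝ := ((certEdge c : ℚ) : ℝ)
  set ec' : ℝ := ((certEdge (c + 1) : ℚ) : ℝ)
  set Q : Set (Fin 3 → ℝ) := {x | ea < x 0 ∧ x 0 < ea' ∧ eb < x 1 ∧ x 1 < eb' ∧ ec < x 2 ∧ x 2 < ec' ∧
      ∑ i, x i < 1 / 2} with hQ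
  have hQpoly : IsConvexPolytope Q := by
    let c0 : Fin 7 → ℝ := fun m => if m = 0 then -1 else if m = 1 then 1 else if m = 6 then 1 else 0
    let c1 : Fin 7 → ℝ := fun m => if m = 2 then -1 else if m = 3 then 1 else if m = 6 then 1 else 0
    let c2 : Fin 7 → ℝ := fun m => if m = 4 then -1 else if m = 5 then 1 else if m = 6 then 1 else 0
    let rhs : Fin 7 → ℝ := fun m => if m = 0 then -ea else if m = 1 then ea' else if m = 2 then -eb
      else if m = 3 then eb' else if m = 4 then -ec else if m = 5 then ec' else 1 / 2
    refine isConvexPolytope_of_constraints (ι₁ := Fin 7) (ι₂ := Fin 0)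
      (fun m l => if l = 0 then c0 m else if l = 1 then c1 m else c2 m) rhs Fin.elim0 Fin.elim0 ?_ fun x => ?_
    · refine (Metric.isBounded_Icc (fun _ : Fin 3 => (0 : ℝ)) (fun _ => 1 / 2)).subset ?_
      intro x hx
      obtain ⟨h1, h2, h3, h4, h5, h6, -⟩ := hx
      have p0 := pos_of_mem_cell ha h1 h2
      have p1 := pos_of_mem_cell hb h3 h4
      have p2 := pos_of_mem_cell hc h5 h6
      refine ⟨fun i => ?_, fun i => ?_⟩ <;> fin_cases i <;> simp <;>
        linarith [p0.1, p1.1, p2.1, p0.2, p1.2, p2.2]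
    · have hsum : ∀ m : Fin 7, ∑ l : Fin 3, (if l = 0 then c0 m else if l = 1 then c1 m else c2 m) * x l =
          c0 m * x 0 + c1 m * x 1 + c2 m * x 2 := by
        intro m; rw [Fin.sum_univ_three]; simp
      have hs3 : ∑ i, x i = x 0 + x 1 + x 2 := Fin.sum_univ_three x
      simp only [hsum, IsEmpty.forall_iff, and_true, hQ, Set.mem_setOf_eq, hs3]
      constructor
      · rintro ⟨h1, h2, h3, h4, h5, h6, h7⟩ m
        fin_cases m <;> simp [c0, c1, c2, rhs] <;> linarith
      · intro h
        have h0 := h 0; have h1 := h 1; have h2 := h 2; have h3 := h 3; have h4 := h 4; have h5 := h 5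
        have h6 := h 6
        simp [c0, c1, c2, rhs] at h0 h1 h2 h3 h4 h5 h6
        refine ⟨by linarith, by linarith, by linarith, by linarith, by linarith, by linarith, by linarith⟩
  have hset : {x : Fin 3 → ℝ | Monotone x ∧ ea < x 0 ∧ x 0 < ea' ∧ eb < x 1 ∧ x 1 < eb' ∧ ec < x 2 ∧ x 2 < ec' ∧
        ∑ i, x i < 1 / 2} = Q ∩ {x | Monotone x} := by
    ext x; simp only [hQ, Set.mem_inter_iff, Set.mem_setOf_eq]; tauto
  rw [hset]
  exact isConvexPolytope_inter_cone hQpoly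

/-! ### `gTab 2` and `gTab 3` are finite sums of table-piece indicators -/

/-- **`gTab 2` on the cone** is the sum over all index triples `q = ((a, b), j) : (Fin 84 × Fin 84) × Fin 2` of
`g2Lookup a b j / 10⁶ ×` the indicator of the table piece of `(a, b, j)`: at a point whose guard holds exactly the piece
of `(cellIdx x₀, cellIdx x₁, bandIdx (x₀ + x₁))` fires. [cite: FordMaynard2024PrimeSieves, Definition 7.2] -/
theorem coneRep_gTab_two :
    ∃ (m : ℕ) (P : Fin m → Set (Fin 2 → ℝ)) (c : Fin m → ℝ),
      (∀ j, IsConvexPolytope (P j) ∧ P j ⊆ {x | Monotone x}) ∧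
        ∀ x : Fin 2 → ℝ, Monotone x → gTab 2 x = ∑ j, if x ∈ P j then c j else 0 := by
  -- the pieces, indexed by `q = ((a, b), j)`
  set T : (Fin 84 × Fin 84) × Fin 2 → Set (Fin 2 → ℝ) := fun q =>
    {x | Monotone x ∧ ((certEdge (q.1.1 : ℕ) : ℚ) : ℝ) < x 0 ∧ x 0 < ((certEdge ((q.1.1 : ℕ) + 1) : ℚ) : ℝ) ∧
      ((certEdge (q.1.2 : ℕ) : ℚ) : ℝ) < x 1 ∧ x 1 < ((certEdge ((q.1.2 : ℕ) + 1) : ℚ) : ℝ) ∧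
      (if (q.2 : ℕ) = 0 then x 0 + x 1 < 8349 / 20000 else (8349 / 20000 : ℝ) < x 0 + x 1) ∧ x 0 + x 1 < 1 / 2}
    with hT
  set F : (Fin 2 → ℝ) → ℝ := fun x =>
    ∑ q : (Fin 84 × Fin 84) × Fin 2,
      (if x ∈ T q then ((g2Lookup (q.1.1 : ℕ) (q.1.2 : ℕ) (q.2 : ℕ) : ℤ) : ℝ) / 1000000 else 0) with hF
  have hA : ∃ (m : ℕ) (P : Fin m → Set (Fin 2 → ℝ)) (c : Fin m → ℝ),
      (∀ j, IsConvexPolytope (P j) ∧ P j ⊆ {x | Monotone x}) ∧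
        ∀ x : Fin 2 → ℝ, Monotone x → F x = ∑ j, if x ∈ P j then c j else 0 := by
    refine coneRep_finset_sum _ _ fun q _ => ?_
    obtain ⟨h1, h2⟩ := isConvexPolytope_cellPiece_two (a := (q.1.1 : ℕ)) (b := (q.1.2 : ℕ))
      (by have := q.1.1.isLt; omega) (by have := q.1.2.isLt; omega) (q.2 : ℕ)
    exact coneRep_indicator' (Q := T q) h1 h2 _
  refine coneRep_congr (fun x hx => ?_) hA
  have hx01 : x 0 ≤ x 1 := hx (by decide)
  by_cases hG : x 0 ≤ x 1 ∧ x 0 ∈ openSmall ∧ x 1 ∈ openSmall ∧ x 0 + x 1 ≠ 8349 / 20000 ∧ x 0 + x 1 < 1 / 2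
  · obtain ⟨-, ho0, ho1, hne, hlt⟩ := hG
    have hval : gTab 2 x = ((g2Lookup (cellIdx (x 0)) (cellIdx (x 1)) (bandIdx (x 0 + x 1)) : ℤ) : ℝ) / 1000000 := by
      show (if _ then _ else _ : ℝ) = _; rw [if_pos ⟨hx01, ho0, ho1, hne, hlt⟩]
    have hs0 := cellIdx_spec ho0.1 ho0.2.1
    have hs1 := cellIdx_spec ho1.1 ho1.2.1
    have hl0 := certEdge_cellIdx_lt ho0
    have hl1 := certEdge_cellIdx_lt ho1
    have hband : bandIdx (x 0 + x 1) < 2 := by unfold bandIdx; split_ifs <;> norm_num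
    set q₀ : (Fin 84 × Fin 84) × Fin 2 :=
      ((⟨cellIdx (x 0), by omega⟩, ⟨cellIdx (x 1), by omega⟩), ⟨bandIdx (x 0 + x 1), hband⟩) with hq₀
    have hxT : x ∈ T q₀ := by
      refine ⟨hx, hl0, hs0.2.2, hl1, hs1.2.2, ?_, hlt⟩
      show (if bandIdx (x 0 + x 1) = 0 then x 0 + x 1 < 8349 / 20000 else (8349 / 20000 : ℝ) < x 0 + x 1)
      unfold bandIdx
      by_cases hb : x 0 + x 1 < 8349 / 20000
      · rw [if_pos hb, if_pos rfl]; exact hb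
      · rw [if_neg hb, if_neg one_ne_zero]
        exact lt_of_le_of_ne (not_lt.1 hb) (fun h => hne h.symm)
    -- only `q₀` fires
    have huniq : ∀ q : (Fin 84 × Fin 84) × Fin 2, x ∈ T q → q = q₀ := by
      intro q hxq
      obtain ⟨-, h1, h2, h3, h4, h5, -⟩ := hxq
      have ea : (q.1.1 : ℕ) = cellIdx (x 0) := (cellIdx_eq_of_mem_cell (by have := q.1.1.isLt; omega) h1 h2).symm
      have eb : (q.1.2 : ℕ) = cellIdx (x 1) := (cellIdx_eq_of_mem_cell (by have := q.1.2.isLt; omega) h3 h4).symm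
      have ej : (q.2 : ℕ) = bandIdx (x 0 + x 1) := by
        unfold bandIdx
        by_cases hj : (q.2 : ℕ) = 0
        · rw [hj] at h5 ⊢; rw [if_pos rfl] at h5; rw [if_pos h5]
        · rw [if_neg hj] at h5; rw [if_neg (not_lt.2 h5.le)]; have := q.2.isLt; omega
      rcases q with ⟨⟨qa, qb⟩, qj⟩
      simp only at ea eb ej
      rw [hq₀]
      ext <;> simp only [ea, eb, ej]
    show F x = gTab 2 x
    rw [hval, hF]
    simp only []
    rw [Finset.sum_eq_single q₀ (fun q _ hne' => if_neg (fun h => hne' (huniq q h))) (fun h => absurd (Finset.mem_univ _) h)]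
    rw [if_pos hxT]
  · have hval : gTab 2 x = 0 := by
      show (if _ then _ else _ : ℝ) = 0; rw [if_neg hG]
    show F x = gTab 2 x
    rw [hval, hF]
    refine Finset.sum_eq_zero fun q _ => ?_
    rw [if_neg]
    intro hxq
    obtain ⟨-, h1, h2, h3, h4, h5, h6⟩ := hxq
    apply hG
    refine ⟨hx01, mem_openSmall_of_mem_cell (by have := q.1.1.isLt; omega) h1 h2,
      mem_openSmall_of_mem_cell (by have := q.1.2.isLt; omega) h3 h4, ?_, h6⟩
    by_cases hj : (q.2 : ℕ) = 0
    · rw [if_pos hj] at h5; exact h5.ne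
    · rw [if_neg hj] at h5; exact h5.ne'

/-- **`gTab 3` on the cone** is the sum over all `q = ((a, b), c) : (Fin 84 × Fin 84) × Fin 84` of
`g3Lookup a b c / 10⁶ ×` the indicator of the table piece of `(a, b, c)`. [cite: FordMaynard2024PrimeSieves, Definition 7.2] -/
theorem coneRep_gTab_three :
    ∃ (m : ℕ) (P : Fin m → Set (Fin 3 → ℝ)) (c : Fin m → ℝ),
      (∀ j, IsConvexPolytope (P j) ∧ P j ⊆ {x | Monotone x}) ∧
        ∀ x : Fin 3 → ℝ, Monotone x → gTab 3 x = ∑ j, if x ∈ P j then c j else 0 := by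
  set T : (Fin 84 × Fin 84) × Fin 84 → Set (Fin 3 → ℝ) := fun q =>
    {x | Monotone x ∧ ((certEdge (q.1.1 : ℕ) : ℚ) : ℝ) < x 0 ∧ x 0 < ((certEdge ((q.1.1 : ℕ) + 1) : ℚ) : ℝ) ∧
      ((certEdge (q.1.2 : ℕ) : ℚ) : ℝ) < x 1 ∧ x 1 < ((certEdge ((q.1.2 : ℕ) + 1) : ℚ) : ℝ) ∧
      ((certEdge (q.2 : ℕ) : ℚ) : ℝ) < x 2 ∧ x 2 < ((certEdge ((q.2 : ℕ) + 1) : ℚ) : ℝ) ∧ ∑ i, x i < 1 / 2} with hT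
  set F : (Fin 3 → ℝ) → ℝ := fun x =>
    ∑ q : (Fin 84 × Fin 84) × Fin 84,
      (if x ∈ T q then ((g3Lookup (q.1.1 : ℕ) (q.1.2 : ℕ) (q.2 : ℕ) : ℤ) : ℝ) / 1000000 else 0) with hF
  have hA : ∃ (m : ℕ) (P : Fin m → Set (Fin 3 → ℝ)) (c : Fin m → ℝ),
      (∀ j, IsConvexPolytope (P j) ∧ P j ⊆ {x | Monotone x}) ∧
        ∀ x : Fin 3 → ℝ, Monotone x → F x = ∑ j, if x ∈ P j then c j else 0 := by
    refine coneRep_finset_sum _ _ fun q _ => ?_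
    obtain ⟨h1, h2⟩ := isConvexPolytope_cellPiece_three (a := (q.1.1 : ℕ)) (b := (q.1.2 : ℕ)) (c := (q.2 : ℕ))
      (by have := q.1.1.isLt; omega) (by have := q.1.2.isLt; omega) (by have := q.2.isLt; omega)
    exact coneRep_indicator' (Q := T q) h1 h2 _
  refine coneRep_congr (fun x hx => ?_) hA
  by_cases hG : Monotone x ∧ (∀ i, x i ∈ openSmall) ∧ ∑ i, x i < 1 / 2
  · obtain ⟨-, ho, hlt⟩ := hG
    have hval : gTab 3 x = ((g3Lookup (cellIdx (x 0)) (cellIdx (x 1)) (cellIdx (x 2)) : ℤ) : ℝ) / 1000000 := by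
      show (if _ then _ else _ : ℝ) = _; rw [if_pos ⟨hx, ho, hlt⟩]
    have hs0 := cellIdx_spec (ho 0).1 (ho 0).2.1
    have hs1 := cellIdx_spec (ho 1).1 (ho 1).2.1
    have hs2 := cellIdx_spec (ho 2).1 (ho 2).2.1
    set q₀ : (Fin 84 × Fin 84) × Fin 84 :=
      ((⟨cellIdx (x 0), by omega⟩, ⟨cellIdx (x 1), by omega⟩), ⟨cellIdx (x 2), by omega⟩) with hq₀
    have hxT : x ∈ T q₀ :=
      ⟨hx, certEdge_cellIdx_lt (ho 0), hs0.2.2, certEdge_cellIdx_lt (ho 1), hs1.2.2,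
        certEdge_cellIdx_lt (ho 2), hs2.2.2, hlt⟩
    have huniq : ∀ q : (Fin 84 × Fin 84) × Fin 84, x ∈ T q → q = q₀ := by
      intro q hxq
      obtain ⟨-, h1, h2, h3, h4, h5, h6, -⟩ := hxq
      have ea : (q.1.1 : ℕ) = cellIdx (x 0) := (cellIdx_eq_of_mem_cell (by have := q.1.1.isLt; omega) h1 h2).symm
      have eb : (q.1.2 : ℕ) = cellIdx (x 1) := (cellIdx_eq_of_mem_cell (by have := q.1.2.isLt; omega) h3 h4).symm
      have ec : (q.2 : ℕ) = cellIdx (x 2) := (cellIdx_eq_of_mem_cell (by have := q.2.isLt; omega) h5 h6).symm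
      rcases q with ⟨⟨qa, qb⟩, qc⟩
      simp only at ea eb ec
      rw [hq₀]
      ext <;> simp only [ea, eb, ec]
    show F x = gTab 3 x
    rw [hval, hF]
    simp only []
    rw [Finset.sum_eq_single q₀ (fun q _ hne' => if_neg (fun h => hne' (huniq q h))) (fun h => absurd (Finset.mem_univ _) h)]
    rw [if_pos hxT]
  · have hval : gTab 3 x = 0 := by
      show (if _ then _ else _ : ℝ) = 0; rw [if_neg hG]
    show F x = gTab 3 x
    rw [hval, hF]
    refine Finset.sum_eq_zero fun q _ => ?_
    rw [if_neg]
    intro hxq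
    obtain ⟨-, h1, h2, h3, h4, h5, h6, h7⟩ := hxq
    apply hG
    refine ⟨hx, fun i => ?_, h7⟩
    fin_cases i
    · exact mem_openSmall_of_mem_cell (by have := q.1.1.isLt; omega) h1 h2
    · exact mem_openSmall_of_mem_cell (by have := q.1.2.isLt; omega) h3 h4
    · exact mem_openSmall_of_mem_cell (by have := q.2.isLt; omega) h5 h6

/-! ### Conjunct (i) -/

/-- **Conjunct (i) of `stub_coneCertClosed` for the witness: `coneCert` is piecewise constant on convex polytopes of
the ordered cone** (dimension `0`: the constant `1`; `1`: `−𝟙(ν₀, 1/2]` plus edge faces; `2`, `3`: table pieces plus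
faces; `≥ 4`: zero). [cite: FordMaynard2024PrimeSieves, Definition 7.2 (the sub-class 𝒮𝒢₁ ⊇ piecewise constant)] -/
theorem isPiecewiseConstOnCone_coneCert : IsPiecewiseConstOnCone coneCert := by
  refine isPiecewiseConstOnCone_of_coneRep coneCert fun k => ?_
  match k with
  | 0 => exact coneRep_coneCert_zero
  | 1 => exact coneRep_coneCert_one
  | 2 =>
      exact coneRep_congr (f := fun x => gTab 2 x + gFace 2 x) (fun x _ => rfl)
        (coneRep_add coneRep_gTab_two (coneRep_gFace 2 (by norm_num) (by norm_num)))
  | 3 =>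
      exact coneRep_congr (f := fun x => gTab 3 x + gFace 3 x) (fun x _ => rfl)
        (coneRep_add coneRep_gTab_three (coneRep_gFace 3 (by norm_num) le_rfl))
  | n + 4 => exact coneRep_coneCert_four_le n

end Summit.Parity.GeneralizedHardyLittlewood.FordMaynardSieveConst01651SieveConst01651

end
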